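import Mathlib
import Literature.Geometry.DiscreteGeometry.KissingPatterns
import Literature.Geometry.DiscreteGeometry.ShellCensusTwelve
import Literature.Geometry.DiscreteGeometry.PrestressEnergyIdentity
import Summits.AtomisticToContinuum.Crystallization.Theses.GappedShellCensus

/-!
# Sketch — crux-ideate stmt-AtomisticToContinuum-18070 (ShellTrichotomy), ideator k = 1, round 1

First-lemma signatures of the two idea cards (they need not be proved here; they must elaborate).

* Card `one-forbidden-star`: `stub_noThreeTrianglesOneQuad` — the face-free local lemma "no shell vertex of
  bond type 3T+Q at (τ, γ) = (1/50, 63/50)"; `stub_allFourValent_fccHcpGraph` — the funnel's output.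
* Card `flex-tube-stress-certificate`: `stub_hcpWheelIsSelfStress` (the equatorial wheel stress of the centred
  hcp pattern), `stub_anticubTube` (a-priori tube localisation along the unique flex), `stub_anticubAccept` /
  `stub_cubAccept` (branch (A) for the two realisable bond graphs, labelled form).
-/

namespace Summit.AtomisticToContinuum.Crystallization.Cruxes.ShellTrichotomy.SketchK1

open Literature.Geometry.DiscreteGeometry Literature.Geometry.DiscreteGeometry.ShellCensus

local notation "E3" => EuclideanSpace ℝ (Fin 3)

/-! ## Card A — one forbidden star -/

/-- **L2 (the forbidden 3T+Q star), face-free form.** Centre `0`; a shell vertex `v` with four bonded shell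
neighbours `u₁ … u₄` such that `u₁u₂, u₂u₃, u₃u₄` are bonds, `u₁u₃, u₂u₄, u₄u₁` are far, and a fifth shell
point `w` bonded to `u₄` and `u₁` and far from `v` (the fourth corner at `v` is a quadrilateral corner) —
impossible at tolerance `1/50` with gap `63/50`.  Numerics (this seat): the azimuthal corner sum at `v` is
coordinate-wise monotone in the 15 lengths and maximal at one vertex of the length box, where it equals
`355.64° < 360°`; threshold `τ⋆ ≈ 0.0241`. -/
theorem stub_noThreeTrianglesOneQuad (v u₁ u₂ u₃ u₄ w : E3)
    (hr : ∀ p ∈ [v, u₁, u₂, u₃, u₄, w], (49 : ℝ) / 50 ≤ ‖p‖ ∧ ‖p‖ ≤ 51 / 50)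
    (hb : ∀ pq ∈ [(v, u₁), (v, u₂), (v, u₃), (v, u₄), (u₁, u₂), (u₂, u₃), (u₃, u₄), (u₄, w), (w, u₁)],
      (49 : ℝ) / 50 ≤ dist pq.1 pq.2 ∧ dist pq.1 pq.2 ≤ 51 / 50)
    (hf : ∀ pq ∈ [(u₁, u₃), (u₂, u₄), (u₄, u₁), (v, w)], (63 : ℝ) / 50 ≤ dist pq.1 pq.2) : False := by
  sorry

/-- **L1 (no 4T vertex)**: four bonded neighbours of `v` forming a bond 4-cycle — impossible (corner sum
`≤ 4 · 75.1° < 360°`). -/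
theorem stub_noFourTriangles (v u₁ u₂ u₃ u₄ : E3)
    (hr : ∀ p ∈ [v, u₁, u₂, u₃, u₄], (49 : ℝ) / 50 ≤ ‖p‖ ∧ ‖p‖ ≤ 51 / 50)
    (hb : ∀ pq ∈ [(v, u₁), (v, u₂), (v, u₃), (v, u₄), (u₁, u₂), (u₂, u₃), (u₃, u₄), (u₄, u₁)],
      (49 : ℝ) / 50 ≤ dist pq.1 pq.2 ∧ dist pq.1 pq.2 ≤ 51 / 50)
    (hf : ∀ pq ∈ [(u₁, u₃), (u₂, u₄)], (63 : ℝ) / 50 ≤ dist pq.1 pq.2) : False := by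
  sorry

/-- The fcc bond graph on labels `Fin 12` (labelling of `fccTuple`). -/
def fccBondIdx : List (Fin 12 × Fin 12) :=
  [(0,4),(0,5),(0,8),(0,9),(1,4),(1,5),(1,10),(1,11),(2,6),(2,7),(2,8),(2,9),(3,6),(3,7),(3,10),(3,11),
   (4,8),(4,10),(5,9),(5,11),(6,8),(6,10),(7,9),(7,11)]

/-- The hcp bond graph on labels `Fin 12` (labelling of `hcpTuple`: `0–5` equatorial hexagon, `6–8` upper cap,
`9–11` lower cap). -/
def hcpBondIdx : List (Fin 12 × Fin 12) :=
  [(0,2),(0,5),(0,7),(0,10),(1,3),(1,4),(1,8),(1,11),(2,4),(2,6),(2,9),(3,5),(3,8),(3,11),(4,6),(4,9),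
   (5,7),(5,10),(6,7),(6,8),(7,8),(9,10),(9,11),(10,11)]

/-- A labelled gapped twelve-shell whose bond graph is exactly `G`. -/
def IsLabelledGappedShell (G : List (Fin 12 × Fin 12)) (t : Fin 12 → E3) : Prop :=
  (∀ k, (49 : ℝ) / 50 ≤ ‖t k‖ ∧ ‖t k‖ ≤ 51 / 50) ∧
  (∀ p ∈ G, (49 : ℝ) / 50 ≤ dist (t p.1) (t p.2) ∧ dist (t p.1) (t p.2) ≤ 51 / 50) ∧
  (∀ i j : Fin 12, i < j → (i, j) ∉ G → (63 : ℝ) / 50 ≤ dist (t i) (t j))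

/-- **Funnel output (Card A)**: an all-4-valent gapped twelve-shell has, after relabelling, exactly the fcc or
the hcp bond graph.  (L1 + L2 + the hexagon-area lemma + the census of the 13 four-regular plane maps on 12
vertices: every map other than the cuboctahedron / anticuboctahedron has a 4T vertex, a 3T+Q vertex, or two
hexagons whose twelve corners are all 3T+H.) -/
theorem stub_allFourValent_fccHcpGraph (T : Finset E3) (hT : T.card = 12)
    (hn : ∀ v ∈ T, 1 - 1 / 50 ≤ ‖v‖ ∧ ‖v‖ ≤ 1 + 1 / 50)
    (hd : ∀ v ∈ T, ∀ w ∈ T, v ≠ w → 1 - 1 / 50 ≤ dist v w ∧ (dist v w ≤ 1 + 1 / 50 ∨ 63 / 50 ≤ dist v w))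
    (h4 : ∀ v ∈ T, (T.filter fun w => w ≠ v ∧ dist v w ≤ 1 + 1 / 50).card = 4) :
    ∃ t : Fin 12 → E3, Set.range t = ↑T ∧
      (IsLabelledGappedShell fccBondIdx t ∨ IsLabelledGappedShell hcpBondIdx t) := by
  sorry

/-! ## Card B — flex tube from the self-stresses -/

/-- The centred hcp pattern: index `0` is the centre, `k+1 ↦ hcpTuple k`. -/
noncomputable def hcpCentred : Fin 13 → E3 := Fin.cons 0 hcpTuple

/-- The equatorial WHEEL stress: rim bonds of the hexagon `+1`, its six spokes `−1`. -/
noncomputable def hcpWheelStress : Fin 13 → Fin 13 → ℝ := fun i j =>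
  if (i.val, j.val) ∈ [(1,3),(3,1),(1,6),(6,1),(2,4),(4,2),(2,5),(5,2),(3,5),(5,3),(4,6),(6,4)] then 1
  else if (i.val = 0 ∧ 1 ≤ j.val ∧ j.val ≤ 6) ∨ (j.val = 0 ∧ 1 ≤ i.val ∧ i.val ≤ 6) then -1 else 0

/-- **The wheel stress is a self-stress of the centred hcp pattern** (one of the four; `dim` of the
self-stress space `= 4`, of the flex space `= 1`, rigidity rank `32` — this seat, `compute/rigidity.py`). -/
theorem stub_hcpWheelIsSelfStress : IsSelfStress hcpCentred hcpWheelStress := by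
  sorry

/-- The unique (up to sign and rotations) infinitesimal flex of the centred hcp framework, scaled so that the cap
vertices move by `1`: equatorial vertices pucker along `±(1,1,1)/(2√2)`, the two caps counter-rotate about the
three-fold axis (integer model times `(2√2)⁻¹`). -/
def hcpFlexVec : Fin 12 → (Fin 3 → ℤ) :=
  ![![-1,-1,-1], ![1,1,1], ![1,1,1], ![-1,-1,-1], ![-1,-1,-1], ![1,1,1],
    ![-2,2,0], ![2,0,-2], ![0,-2,2], ![2,-2,0], ![-2,0,2], ![0,2,-2]]

/-- The hcp flex direction as a tuple of `ℝ³`. -/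
noncomputable def hcpFlexDir (k : Fin 12) : E3 := (2 * Real.sqrt 2)⁻¹ • intVec (hcpFlexVec k)

/-- **Tube localisation (Card B, a-priori estimate)**: every labelled hcp-graph gapped shell lies, after a linear
isometry, within `1/10` (numerically ≲ 0.04) of the straightened flex line `hcpTuple + θ • hcpFlexDir` with `|θ| ≤ 1/5` — the stress
energy identity bounds `θ` (stress-only bound `0.267`, far-strut cut `0.147` at exact lengths), the restricted
rigidity matrix bounds the transverse part. -/
theorem stub_anticubTube (t : Fin 12 → E3) (ht : IsLabelledGappedShell hcpBondIdx t) :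
    ∃ A : E3 →ₗᵢ[ℝ] E3, ∃ θ : ℝ, |θ| ≤ 1 / 5 ∧
      ∀ k, dist (t k) (A (hcpTuple k + θ • hcpFlexDir k)) ≤ 1 / 10 := by
  sorry

/-- **Branch (A) for the anticuboctahedral graph** (labelled; refuter's adversarial maximum `0.1765`). -/
theorem stub_anticubAccept (t : Fin 12 → E3) (ht : IsLabelledGappedShell hcpBondIdx t) :
    ∃ A : E3 →ₗᵢ[ℝ] E3, ∀ k, dist (t k) (A (hcpTuple k)) ≤ 1 / 5 := by
  sorry

/-- **Branch (A) for the cuboctahedral graph** (labelled; refuter's adversarial maximum `0.1445`). -/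
theorem stub_cubAccept (t : Fin 12 → E3) (ht : IsLabelledGappedShell fccBondIdx t) :
    ∃ A : E3 →ₗᵢ[ℝ] E3, ∀ k, dist (t k) (A (fccTuple k)) ≤ 1 / 5 := by
  sorry

/-- Sanity: the crux decl is in scope and is what the two cards compose to. -/
example : Summit.AtomisticToContinuum.Crystallization.Theses.GappedShellCensus.ShellTrichotomy =
    (∀ T : Finset E3, T.card = 12 → (∀ v ∈ T, 1 - 1 / 50 ≤ ‖v‖ ∧ ‖v‖ ≤ 1 + 1 / 50) →
      (∀ v ∈ T, ∀ w ∈ T, v ≠ w → 1 - 1 / 50 ≤ dist v w ∧ (dist v w ≤ 1 + 1 / 50 ∨ 63 / 50 ≤ dist v w)) →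
      ShellCloseTo (1 / 5) T fccKissingPattern ∨ ShellCloseTo (1 / 5) T hcpKissingPattern ∨
      (∃ v ∈ T, 5 ≤ (T.filter fun w => w ≠ v ∧ dist v w ≤ 1 + 1 / 50).card) ∨
      (∃ v ∈ T, (T.filter fun w => w ≠ v ∧ dist v w ≤ 1 + 1 / 50).card ≤ 3)) := rfl

end Summit.AtomisticToContinuum.Crystallization.Cruxes.ShellTrichotomy.SketchK1

/-! ## Card C — two matchings, no census: the all-2T2Q classification as a finite combinatorial statement -/

namespace Summit.AtomisticToContinuum.Crystallization.Cruxes.ShellTrichotomy.SketchK1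

/-- Index of `v` in the rotation at `w` (junk `0` if absent; hypotheses exclude the junk case). -/
def rotIdx (rot : Fin 12 → Fin 4 → Fin 12) (w v : Fin 12) : Fin 4 :=
  ((List.finRange 4).find? (fun j => rot w j = v)).getD 0

/-- Face-tracing permutation on darts `(v, i)` = "the edge from `v` to its `i`-th neighbour": go to
`w = rot v i` and turn to the neighbour of `w` following `v` in the rotation at `w`. -/
def dartNext (rot : Fin 12 → Fin 4 → Fin 12) (d : Fin 12 × Fin 4) : Fin 12 × Fin 4 :=
  (rot d.1 d.2, rotIdx rot (rot d.1 d.2) d.1 + 1)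

/-- Adjacency of the rotation system. -/
def RotAdj (rot : Fin 12 → Fin 4 → Fin 12) (v w : Fin 12) : Prop := ∃ i, rot v i = w

/-- **All-2T2Q classification (Card C, census-free core).** A rotation system of a simple 4-regular graph on
12 vertices all of whose faces are triangles or quadrilaterals and every vertex of which has exactly two
triangular corners (hence 8 triangles, 6 quadrilaterals, Euler characteristic 2) is, up to relabelling, the
cuboctahedral (`fccBondIdx`) or the anticuboctahedral (`hcpBondIdx`) graph.  Hand proof: TTQQ-vertices carry
two disjoint perfect matchings (T–T and Q–Q edges); β = #TTQQ ∈ {0, 6}; β = 0 ⇒ medial graph of the cube;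
β = 6 ⇒ two triangular cupolae glued ortho along the TTQQ hexagon. -/
theorem stub_allTwoTtwoQ_classification (rot : Fin 12 → Fin 4 → Fin 12)
    (hinj : ∀ v, Function.Injective (rot v)) (hirr : ∀ v i, rot v i ≠ v)
    (hsymm : ∀ v i, RotAdj rot (rot v i) v)
    (hfaces : ∀ d, (dartNext rot)^[3] d = d ∨ (dartNext rot)^[4] d = d)
    (h2T2Q : ∀ v : Fin 12, (Finset.univ.filter fun i : Fin 4 => (dartNext rot)^[3] (v, i) = (v, i)).card = 2) :
    ∃ σ : Fin 12 ≃ Fin 12,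
      (∀ v w, RotAdj rot v w ↔ ((σ v, σ w) ∈ fccBondIdx ∨ (σ w, σ v) ∈ fccBondIdx)) ∨
      (∀ v w, RotAdj rot v w ↔ ((σ v, σ w) ∈ hcpBondIdx ∨ (σ w, σ v) ∈ hcpBondIdx)) := by
  sorry

/-- **Apex squeeze (Card C), single big face**: with exactly one face of size ≥ 5, no two consecutive corners of
it can both be 3T-corners — so the face vectors (9,4,1) and (10,3,0,1) are impossible once 4T and 3T+Q
vertices are excluded.  Stated for one pentagon: faces ∈ {3,4,5}, exactly 5 darts on 5-faces, no vertex with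
three triangular corners and a quadrilateral corner, no 4T vertex ⇒ False. -/
theorem stub_noLonePentagon (rot : Fin 12 → Fin 4 → Fin 12)
    (hinj : ∀ v, Function.Injective (rot v)) (hirr : ∀ v i, rot v i ≠ v)
    (hsymm : ∀ v i, RotAdj rot (rot v i) v)
    (hfaces : ∀ d, (dartNext rot)^[3] d = d ∨ (dartNext rot)^[4] d = d ∨ (dartNext rot)^[5] d = d)
    (hone : (Finset.univ.filter fun d : Fin 12 × Fin 4 =>
        (dartNext rot)^[5] d = d ∧ (dartNext rot)^[3] d ≠ d ∧ (dartNext rot)^[4] d ≠ d).card = 5)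
    (heuler : (Finset.univ.filter fun d : Fin 12 × Fin 4 => (dartNext rot)^[3] d = d).card = 27)
    (hno4T : ∀ v, (Finset.univ.filter fun i : Fin 4 => (dartNext rot)^[3] (v, i) = (v, i)).card ≤ 3)
    (hno3TQ : ∀ v, (Finset.univ.filter fun i : Fin 4 => (dartNext rot)^[3] (v, i) = (v, i)).card = 3 →
        ∀ i, (dartNext rot)^[4] (v, i) ≠ (v, i) ∨ (dartNext rot)^[3] (v, i) = (v, i)) : False := by
  sorry

end Summit.AtomisticToContinuum.Crystallization.Cruxes.ShellTrichotomy.SketchK1
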